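import Literature.MathematicalPhysics.QuantumFieldTheory.Balaban1983to89.B8Ineq133Rec
import Literature.MathematicalPhysics.QuantumFieldTheory.Balaban1983to89.B8Eq119TwistedAxialRec
import Literature.MathematicalPhysics.QuantumFieldTheory.Balaban1983to89.B8Ineq132

/-!
# `Balaban1983to89.B8Ineq132Rec` — [Balaban1985RegularSpaces] (1.132) p. 99, «`U₀″ ∈ 𝔄_k({□_j}, L³α₀) ∩ Ax_k(ℭ_k, 1)`», FOR THE RECORD TOWER ([Balaban1987RG1] (0.4)):
# `ineq132` — the record twin of `B8Ineq132.ineq132` (LEAD PEN dag-n05-e; cell member dag-n05-d), with the two box-generic transport lemmas it needs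

statement-level skeleton of published theorems with citation tags; proofs where landed; nothing here is a claim about the Yang–Mills mass gap

CITATION HEADER.  [6] = [Balaban1985RegularSpaces], (1.7)∕(1.9) p. 77 (`𝔄_k({Ω_j}, α₀)`), (1.19)–(1.20) p. 79 (`Ax_k(𝔅_k, U₀)`), p. 98 («thus □̃ ⊂ Ω_{k−1}»), (1.132)–(1.133) p. 99;
[I] = [Balaban1987RG1] (0.4) p. 253.  Cell `pub-ymgap`, seat dag-n05-d g23, «N05-REC» road item R4 (TOKEN RULE (T1)∕(T2)∕(T5): `avgIter ↦ avgIterZ`, centred tower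
`B8Ineq130Rec.tlo ∕ thi`, `boxVec ↦ offZ`, `InAxOne ↦ B8Eq119TwistedAxialRec.InAxOneZ`, `cutFixed ↦ B8Ineq133Rec.cutFixedZ`).  REUSED verbatim (class 0): `B8Ineq132.InAk ∕
CondAt ∕ Collar ∕ BondTouches ∕ PlaqTouches ∕ plaq_inBox ∕ stencil_inBox ∕ covDiv_congr ∕ norm_covDiv_gaugeAct ∕ thr7_le_cube ∕ thr9_le_cube ∕ pdevOn_lt_of_forall`.  The engine states
`pdevOn_lt_of_inAk` and `inAk_cutCfg_gaugeAct` on ITS (corner-based) tower boxes; §1 restates them for an ARBITRARY box (same proofs), which the centred tower then instantiates.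
`--kind proof --supports stmt-QuantumFields-20541` (K0⁷; count-neutral; no definition).

WHAT IS PROVED (sorry-free).  §1 `pdevOn_lt_of_inAk_box` ((1.7) on a box inside some `Ω_l`, `k ≤ l + 1`), `inAk_cutCfg_gaugeAct_box` ((1.132) `𝔄`-part for the cut-off of any
`U1`-gauge transform to any box carrying the collars).  §2 ★★★ `ineq132` — (1.132) `U₀″ ∈ 𝔄_k({□_j}, L³α₀)` (`InAk`) and `U₀″ ∈ Ax_k(ℭ_k, 1)` (`InAxOneZ`), and (1.133) on every
bond of every `□̃^{(k−n)}`, for `U₀″ = cutFixedZ L lo hi U₀ k y`, record tower, odd `L ≥ 3`.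
HONEST SCOPE.  Exactly the engine module's §4–§5 content with the record substitutions; nothing of [6] beyond (1.132)–(1.133) is asserted; `HThm4Rec` UNDISCHARGED; N05 ∕ N07
NOT discharged; counts unmoved; one finite 𝕋⁴ programme at fixed ε — nothing continuum ∕ ℝ⁴ ∕ OS ∕ mass gap ∕ Clay.  No `def`, no `instance`, no `notation`, no `sorry`.
-/

noncomputable section

open scoped BigOperators
open NormedSpace Finset

namespace Literature.MathematicalPhysics.QuantumFieldTheory.Balaban1983to89.B8Ineq132Rec

open B7Prop1Explicit MatrixLog BlockAveragingZd B8Lemma1NonAbelianRecLoops B8Lemma1NonAbelianRec B8Ineq130Rec B8Eq115GaugeFixingRec B8Ineq128Rec B8Ineq133Rec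
open B7Prop2Explicit (pdev c2' hol_plaqWord_self)
open B7Prop2Rec (AvgClosedZ C0Z)
open B7Prop1Local (InBox AgreeOn pdevOn)
open B8Ineq130 (inBox_of_le hol_plaqWord_congr)
open B7AvgGaugeCovariance (norm_hol_gaugeAct_plaqWord)
open B8Ineq133 (cutCfg cutCfg_agree)
open B8Ineq132 (InAk CondAt Collar BondTouches PlaqTouches plaqF covDiv plaq_inBox stencil_inBox covDiv_congr norm_covDiv_gaugeAct
  thr7_le_cube thr9_le_cube pdevOn_lt_of_forall)
open B8Eq119TwistedAxialRec (InAxOneZ inAxOneZ_of_tower)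

-- `Site` alone would resolve to the torus sites of `Setup.lean`; re-export the `ℤᵈ` sites of `B7Prop1Explicit`.
export B7Prop1Explicit (Site)

variable {d : ℕ}

variable {𝔸 : Type*} [NormedRing 𝔸] [NormOneClass 𝔸] [NormedAlgebra ℂ 𝔸] [CompleteSpace 𝔸]

/-! ## §1 The two transport lemmas of `B8Ineq132` for an arbitrary box -/

omit [NormOneClass 𝔸] [CompleteSpace 𝔸] in
/-- (`B8Ineq132.pdevOn_lt_of_inAk` for an ARBITRARY box.) If the box `[lo, hi]` lies in some `Ω_l`, `l ≤ k ≤ l + 1` (print: «□̃ ⊂ Ω_{k−1}», p. 98), and `U ∈ 𝔄_k({Ω_j}, α)`,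
then `sup_{p ⊂ [lo, hi]} |U(∂p) − 1| < αL²·L^{−2k}`. [cite: Balaban1985RegularSpaces, p.98 ("thus □̃ ⊂ Ω_{k−1}"), (1.7) p.77] -/
theorem pdevOn_lt_of_inAk_box {L : ℕ} (hL : 1 ≤ L) {k : ℕ} {η α : ℝ} (hα : 0 < α) {Ω : ℕ → Set (Site d)}
    {U : Site d → Fin d → 𝔸ˣ} (hA : InAk L k η α Ω U) {lo hi : Site d}
    (hΩ : ∃ l, l ≤ k ∧ k ≤ l + 1 ∧ ∀ x, InBox lo hi x → x ∈ Ω l) :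
    pdevOn lo hi U < α * (L : ℝ) ^ 2 * (((L : ℝ) ^ k)⁻¹) ^ 2 := by
  obtain ⟨l, hlk, hkl, hsub⟩ := hΩ
  have hL1 : (1 : ℝ) ≤ L := by exact_mod_cast hL
  have hthr : α * (((L : ℝ) ^ l)⁻¹) ^ 2 ≤ α * (L : ℝ) ^ 2 * (((L : ℝ) ^ k)⁻¹) ^ 2 := by
    have h1 : (L : ℝ) ^ k ≤ (L : ℝ) ^ (l + 1) := pow_le_pow_right₀ hL1 hkl
    have h2 : ((L : ℝ) ^ k) ^ 2 ≤ (L : ℝ) ^ 2 * ((L : ℝ) ^ l) ^ 2 := by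
      calc ((L : ℝ) ^ k) ^ 2 ≤ ((L : ℝ) ^ (l + 1)) ^ 2 := pow_le_pow_left₀ (by positivity) h1 2
        _ = (L : ℝ) ^ 2 * ((L : ℝ) ^ l) ^ 2 := by ring
    rw [inv_pow, inv_pow, ← div_eq_mul_inv, ← div_eq_mul_inv,
      div_le_div_iff₀ (by positivity) (by positivity)]
    calc α * ((L : ℝ) ^ k) ^ 2 ≤ α * ((L : ℝ) ^ 2 * ((L : ℝ) ^ l) ^ 2) := mul_le_mul_of_nonneg_left h2 hα.le
      _ = α * (L : ℝ) ^ 2 * ((L : ℝ) ^ l) ^ 2 := by ring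
  refine pdevOn_lt_of_forall (by positivity) fun x μ ν hx hx' => ?_
  rcases eq_or_ne μ ν with rfl | hμν
  · rw [hol_plaqWord_self, Units.val_one, sub_self, norm_zero]; positivity
  · exact ((hA l hlk).1 x μ ν hμν (Or.inl (hsub x hx))).trans_le hthr

omit [CompleteSpace 𝔸] in
/-- (`B8Ineq132.inAk_cutCfg_gaugeAct` for an ARBITRARY box.) **(1.132), `𝔄`-part, for every gauge transformation**: `U₀ ∈ 𝔄_k({Ω_j}, α)`, `u` `U1`-valued, `U₀″` the cut-off of
`U₀^{u}` to the box `[lo, hi]`; if every `□_j`, `j ≤ k`, lies in some `Ω_l`, `l ≤ k`, `j ≤ l + 1`, with one lattice spacing of collar inside the box, then `U₀″ ∈ 𝔄_k({□_j}, L³α)`.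
[cite: Balaban1985RegularSpaces, (1.132) p.99, (1.7)/(1.9)/(1.11) p.77, p.98] -/
theorem inAk_cutCfg_gaugeAct_box {L : ℕ} (hL : 1 ≤ L) {k : ℕ} {η α : ℝ} (hη : 0 < η) (hα : 0 ≤ α)
    {Ω sq : ℕ → Set (Site d)} {U : Site d → Fin d → 𝔸ˣ} (hA : InAk L k η α Ω U) {u : Site d → 𝔸ˣ}
    (hu : ∀ x, u x ∈ U1 𝔸) {lo hi : Site d}
    (hsq : ∀ j, j ≤ k → ∃ l, l ≤ k ∧ j ≤ l + 1 ∧ sq j ⊆ Ω l)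
    (hcol : ∀ j, j ≤ k → Collar (sq j) lo hi) :
    InAk L k η ((L : ℝ) ^ 3 * α) sq (cutCfg lo hi (gaugeAct u U)) := by
  intro j hj
  obtain ⟨l, hlk, hjl, hsub⟩ := hsq j hj
  obtain ⟨h7, h9⟩ := hA l hlk
  have hag : AgreeOn lo hi (cutCfg lo hi (gaugeAct u U)) (gaugeAct u U) := cutCfg_agree _ _ _
  constructor
  · intro x μ ν hμν hp
    obtain ⟨hx, hx'⟩ := plaq_inBox (hcol j hj) hμν hp
    have hp' : PlaqTouches (Ω l) x μ ν := by
      rcases hp with hp | hp | hp | hp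
      exacts [Or.inl (hsub hp), Or.inr (Or.inl (hsub hp)), Or.inr (Or.inr (Or.inl (hsub hp))),
        Or.inr (Or.inr (Or.inr (hsub hp)))]
    unfold plaqF
    rw [hol_plaqWord_congr hag x μ ν hx hx', norm_hol_gaugeAct_plaqWord hu]
    exact (h7 x μ ν hμν hp').trans_le (thr7_le_cube hL hα hjl)
  · intro x μ hb
    have hb' : BondTouches (Ω l) x μ := by
      rcases hb with hb | hb
      exacts [Or.inl (hsub hb), Or.inr (hsub hb)]
    rw [covDiv_congr η hag μ x fun y hy => stencil_inBox (hcol j hj) hb hy, norm_covDiv_gaugeAct η hu]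
    exact (h9 x μ hb').trans_le (thr9_le_cube hL hα hη hjl)

/-! ## §2 (1.132) and (1.133) for the record tower -/

/-- **(1.132) AND (1.133), p. 99, FOR EVERY ORBIT, LOCAL CARRIER, RECORD TOWER** (twin of `B8Ineq132.ineq132`): for `U₀″ = B8Ineq133Rec.cutFixedZ L lo hi U₀ k y` and every
`G`-valued `U₀ ∈ 𝔄_k({Ω_j}, α₀)` (`G` `AvgClosedZ`, `η > 0`) such that the finest centred cube `□̃ = [tlo k, thi k]` lies in some `Ω_l`, `k ≤ l + 1` («□̃ ⊂ Ω_{k−1}»), every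
`□_j`, `j ≤ k`, lies in some `Ω_l`, `j ≤ l + 1`, with one lattice spacing of collar in `□̃`, every `Λ′_j`, `1 ≤ j ≤ k`, lies in `□̃^{(j)}`, and the record's Prop.-1∕2 smallness and
the size hypotheses of `B8Ineq128Rec.ineq130_fixed` hold (odd `L ≥ 3`): (1.132) `U₀″ ∈ 𝔄_k({□_j}, L³α₀)` (`InAk`) and `U₀″ ∈ Ax_k(ℭ_k, 1)` (`InAxOneZ`, centred block contours),
and (1.133) `|Ū₀″^{k−n}(x, x + e_ν) − 1| < 6dL²Mα₀` on every bond of every `□̃^{(k−n)}`. [cite: Balaban1985RegularSpaces, (1.132)-(1.133) p.99, (1.7)/(1.9) p.77, (1.19) p.79, p.98; Balaban1987RG1, (0.4) p.253] -/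
theorem ineq132 {L s : ℕ} (hLs : L = 2 * s + 1) (hL : 2 ≤ L) (hd : 1 ≤ d) {G : Subgroup 𝔸ˣ} (hG : AvgClosedZ d L G) (k : ℕ)
    (U : Site d → Fin d → 𝔸ˣ) (hU : ∀ x κ, U x κ ∈ G) {α₀ : ℝ} (hα : 0 < α₀)
    (hα3 : C0Z d * (α₀ * (L : ℝ) ^ 2) ≤ 1 / 3) (hα2 : 2 * (α₀ * (L : ℝ) ^ 2) ≤ c2' d L)
    (lo hi : Site d) (hlohi : lo ≤ hi) {η : ℝ} (hη : 0 < η) {Ω : ℕ → Set (Site d)}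
    (hA : InAk L k η α₀ Ω U)
    (hΩ : ∃ l, l ≤ k ∧ k ≤ l + 1 ∧ ∀ x, InBox (tlo L lo k) (thi L hi k) x → x ∈ Ω l)
    {sq : ℕ → Set (Site d)} (hsq : ∀ j, j ≤ k → ∃ l, l ≤ k ∧ j ≤ l + 1 ∧ sq j ⊆ Ω l)
    (hcol : ∀ j, j ≤ k → Collar (sq j) (tlo L lo k) (thi L hi k))
    {Λ : ℕ → Set (Site d)} (hΛ : ∀ j, 1 ≤ j → j ≤ k → ∀ x ∈ Λ j, tlo L lo (k - j) ≤ x ∧ x ≤ thi L hi (k - j))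
    {y : Site d} {h : ℕ} (hy : lo ≤ y) (hy' : y ≤ hi) (hrad : ∀ κ, y κ - lo κ ≤ h ∧ hi κ - y κ ≤ h)
    {M R₁ M₁ : ℝ} (hside : 2 * (h : ℝ) ≤ M + 4 * R₁ * M₁) (hRM : R₁ * M₁ ≤ M) (hM : 11 * (d : ℝ) < M)
    (hsmall : 11 * (d : ℝ) ^ 2 * (L : ℝ) ^ 2 * α₀ + (M + 4 * R₁ * M₁) * d * (L : ℝ) ^ 2 * α₀ ≤ 1 / 6) :
    InAk L k η ((L : ℝ) ^ 3 * α₀) sq (cutFixedZ L lo hi U k y) ∧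
    InAxOneZ L k Λ (cutFixedZ L lo hi U k y) ∧
    ∀ (n : ℕ), n ≤ k → ∀ (x : Site d) (ν : Fin d), tlo L lo n ≤ x → x + e ν ≤ thi L hi n →
      ‖((avgIterZ L (cutFixedZ L lo hi U k y) (k - n) x ν : 𝔸ˣ) : 𝔸) - 1‖ < 6 * d * (L : ℝ) ^ 2 * M * α₀ := by
  have hL1 : 1 ≤ L := le_trans (by norm_num) hL
  have hLo : Odd L := ⟨s, hLs⟩
  have h17 : pdevOn (tlo L lo k) (thi L hi k) U < α₀ * (L : ℝ) ^ 2 * (((L : ℝ) ^ k)⁻¹) ^ 2 :=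
    pdevOn_lt_of_inAk_box hL1 hα hA hΩ
  have huG := (ineq130_fixed hLs hL hd hG k U hU hα hα3 hα2 lo hi hlohi h17 hy hy' hrad hside hRM hM hsmall).1
  have huU : ∀ x, localGaugeZ L lo hi U k y x ∈ U1 𝔸 := fun x => hG.le_U1 (huG x)
  obtain ⟨-, -, -, h15, -, h133⟩ :=
    ineq133 hLs hL hd hG k U hU hα hα3 hα2 lo hi hlohi h17 hy hy' hrad hside hRM hM hsmall
  exact ⟨inAk_cutCfg_gaugeAct_box hL1 hη hα.le hA huU hsq hcol, inAxOneZ_of_tower hLo h15 hΛ, h133⟩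

end Literature.MathematicalPhysics.QuantumFieldTheory.Balaban1983to89.B8Ineq132Rec

/-! ## Axiom audit (gate whitelist: `propext`, `Classical.choice`, `Quot.sound`) -/
#print axioms Literature.MathematicalPhysics.QuantumFieldTheory.Balaban1983to89.B8Ineq132Rec.ineq132
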